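import Mathlib
import Literature.Computability.MetaComplexity.TruthTables

/-!
# The cube enumeration reads binary, least significant bit first

Helper for line Sketch/LAR (shift inequality of annihilator ranks) of crux
stmt-QuantumAdvantage-1392, wave-4 support: for the tree's enumeration
`boolFunEquivFin n : (Fin n → Bool) ≃ Fin (2 ^ n)` of the Boolean cube (built from Mathlib's
`finTwoEquiv` and `finFunctionFinEquiv`, digits least significant first) the index of an
`(n+1)`-bit vector splits off its lowest bit,

  `val(b₀, …, b_n) = [b₀] + 2 · val(b₁, …, b_n)`,

where `val b = ((boolFunEquivFin n b : Fin (2 ^ n)) : ℕ) = ∑ i, [b i] · 2 ^ i`. This is the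
recursion that lets the Liouville sign of `val (0, b')` be read as `λ(2 · val b') = -λ(val b')`.
-/

namespace Summit.QuantumAdvantage.DigitPolyUniformity.SketchLAR

open Finset Module
open Literature.Computability.MetaComplexity (boolFunEquivFin)

namespace ValSucc

/-- The index of a cube point in the tree's enumeration is the number spelled by its bits,
least significant first: `val b = ∑ i, [b i] · 2 ^ i` (cf. `finFunctionFinEquiv_apply`; the
digit `finTwoEquiv.symm (b i)`, read in `ℕ`, is `[b i]`). [folklore] -/
theorem val_eq_sum {n : ℕ} (b : Fin n → Bool) :
    ((boolFunEquivFin n b : Fin (2 ^ n)) : ℕ) =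
      ∑ i : Fin n, (if b i then 1 else 0) * 2 ^ (i : ℕ) := by
  rw [boolFunEquivFin, Equiv.trans_apply, finFunctionFinEquiv_apply]
  refine Finset.sum_congr rfl fun i _ => ?_
  simp only [Equiv.arrowCongr_apply, Equiv.refl_symm, Equiv.coe_refl, Function.comp_apply,
    id_eq]
  cases b i <;> rfl

end ValSucc

/-- **The cube enumeration reads binary, LSB first**: the index of an `(n+1)`-bit vector `b` in
the enumeration `boolFunEquivFin` is its lowest bit plus twice the index of its tail,
`val(b₀, …, b_n) = [b₀] + 2 · val(b₁, …, b_n)`. [folklore] -/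
theorem stub_val_succ {n : ℕ} (b : Fin (n + 1) → Bool) :
    ((boolFunEquivFin (n + 1) b : Fin (2 ^ (n + 1))) : ℕ) =
      (if b 0 then 1 else 0) +
        2 * ((boolFunEquivFin n (fun i => b i.succ) : Fin (2 ^ n)) : ℕ) := by
  rw [ValSucc.val_eq_sum, ValSucc.val_eq_sum, Fin.sum_univ_succ, Finset.mul_sum]
  simp only [Fin.val_zero, pow_zero, mul_one, Fin.val_succ, pow_succ]
  congr 1
  refine Finset.sum_congr rfl fun i _ => ?_
  ring

end Summit.QuantumAdvantage.DigitPolyUniformity.SketchLAR
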